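import Literature.NumberTheory.LFunctions.Zhang2022.Section10Lemma101Tent
import Literature.NumberTheory.LFunctions.Zhang2022.TypedSection10A
import HarnessLib

/-!
# Zhang (2022), Lemma 10.2 — the tent decomposition of `𝔳₂ⱼ(d,r)` into three untwisted log-means,
# and the residues that the manuscript's circle integrals collect

Topic `Literature/NumberTheory/LFunctions/Zhang2022` (Landau–Siegel audit tree; verdict-neutral).
Y. Zhang, *Discrete mean estimates and the Landau–Siegel zero*, arXiv:2211.02515v1 (2022)
[Zhang2022LandauSiegel] — **an unrefereed manuscript under adjudication**; DAG nodes `Z22:Lem10.2.pf`,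
`Z22:§10.u018/u019/u021/u022` [Z22 pp.55–56, tex L2823–L2851].

The proof of Lemma 10.2 begins "In view of (8.9) and (10.6), we have `𝔳₂ⱼ(d,r) = (500/log P)·∫_{(1)} …
((P′₁)ˢ − 2(P′₂)ˢ + (P′₃)ˢ)(dr)⁻ˢ ds/s²`". The elementary content of (10.6) (the tent `f̃` as three
logarithmic ramps, `Lemma101.ftilde_log_eq`) gives this WITHOUT any integral:

* `sum_ramp_eq'` — `Σ_{1≤n<Q} w(n)(log(X/n))⁺ = Σ_{n≤X} w(n)log(X/n)` for `0 < X ≤ Q` (any weight `w`;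
  `Lemma101.sum_ramp_eq` is the case of the twisted weights of Lemma 10.1);
* `frakv2_eq_logMeans` — **`𝔳₂ⱼ(d,r) = (500/log P)(A(P^{0.504}/dr) − 2A(P^{0.502}/dr) + A(P^{0.5}/dr))`**
  with the UNTWISTED log-weighted means `A(X) = Σ_{n≤X} χ(n)ξ₀ⱼ(n;d,r)n⁻¹log(X/n)` — the sums of
  Lemma 8.4 at shift `β_μ = 0`; when `X < 1` the mean is an empty sum (`logMean_eq_zero_of_lt_one`),
  which is why the manuscript's displays for the second and third ranges (u021, u022) drop the
  `(P′₃)ˢ` resp. `(P′₂)ˢ, (P′₃)ˢ` terms;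
* `resComb_three`, `resComb_two`, `resComb_one` — the residue of the shift-0 model
  `(1 + (β_a+β_b)log X + ½β_aβ_b log²X)` (cf. `Section10Lemma102Model`) combined over the tent equals
  the value of the manuscript's circle integral (L3-t1's `Typed.Sec10A.residue102a/b/c_eq`):
  `Σ_k c_k(…)(X_k) = β_aβ_b(log P/500)²`, `−1 + 𝔶₁ⱼ(dr)`, `1 + 𝔶₂ⱼ(dr)` respectively
  (`Σc_k = Σc_k log X_k = 0`, `Σc_k log²X_k = 2(log P/500)²`).

Nothing about the manuscript's Theorems 1–2 or about Landau–Siegel zeros is asserted.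

## References

* Y. Zhang, arXiv:2211.02515v1 (2022), §10 Lemma 10.2 and its proof, (10.6), (10.8)–(10.10).
  [cite: Zhang2022LandauSiegel, §10 Lemma 10.2]
-/

noncomputable section

open Complex Real

namespace Literature.NumberTheory.LFunctions.Zhang2022.Lemma102

open Literature.NumberTheory.LFunctions.Zhang2022.Skeleton
open Literature.NumberTheory.LFunctions.Zhang2022.Lemma101 (ftilde_log_eq)

variable {D : ℕ} (χ : DirichletCharacter ℂ D)

/-! ### The tent decomposition -/

/-- The ramp-weighted sum over `1 ≤ n < Q` is the log-weighted mean over `n ≤ X`, provided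
`0 < X ≤ Q` (any weight `w`). [cite: Zhang2022LandauSiegel, §10 (10.6)] -/
theorem sum_ramp_eq' (w : ℕ → ℂ) {X : ℝ} {Q : ℕ} (hX : 0 < X) (hXQ : X ≤ Q) :
    ∑ n ∈ Finset.Ico 1 Q, w n * ((max (Real.log (X / n)) 0 : ℝ) : ℂ) =
      ∑ n ∈ Finset.Ioc 0 ⌊X⌋₊, w n * (Real.log (X / n) : ℂ) := by
  classical
  set g : ℕ → ℂ := fun n => w n * ((max (Real.log (X / n)) 0 : ℝ) : ℂ) with hg
  have hS1 : ∑ n ∈ Finset.Ico 1 Q, g n = ∑ n ∈ Finset.Ioc 0 ⌊X⌋₊ ∪ Finset.Ico 1 Q, g n := by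
    refine Finset.sum_subset Finset.subset_union_right fun n hn hn' => ?_
    rw [Finset.mem_union] at hn
    have hn1 : n ∈ Finset.Ioc 0 ⌊X⌋₊ := hn.resolve_right hn'
    rw [Finset.mem_Ioc] at hn1
    have hQn : Q ≤ n := by
      by_contra h
      exact hn' (Finset.mem_Ico.mpr ⟨hn1.1, not_le.mp h⟩)
    have h1 : (n : ℝ) ≤ X := (Nat.cast_le.mpr hn1.2).trans (Nat.floor_le hX.le)
    have h2 : X ≤ n := hXQ.trans (Nat.cast_le.mpr hQn)
    have hnX : (n : ℝ) = X := le_antisymm h1 h2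
    have : Real.log (X / n) = 0 := by rw [hnX, div_self hX.ne', Real.log_one]
    simp [hg, this]
  have hS2 : ∑ n ∈ Finset.Ioc 0 ⌊X⌋₊, w n * (Real.log (X / n) : ℂ) =
      ∑ n ∈ Finset.Ioc 0 ⌊X⌋₊ ∪ Finset.Ico 1 Q, g n := by
    rw [← Finset.sum_subset Finset.subset_union_left]
    · refine Finset.sum_congr rfl fun n hn => ?_
      rw [Finset.mem_Ioc] at hn
      have hn0 : (0 : ℝ) < n := by exact_mod_cast hn.1
      have hnX : (n : ℝ) ≤ X := (Nat.cast_le.mpr hn.2).trans (Nat.floor_le hX.le)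
      have : 0 ≤ Real.log (X / n) := Real.log_nonneg ((one_le_div hn0).mpr hnX)
      simp only [hg, max_eq_left this]
    · intro n hn hn'
      rw [Finset.mem_union] at hn
      have hn1 : n ∈ Finset.Ico 1 Q := hn.resolve_left hn'
      rw [Finset.mem_Ico] at hn1
      have hn0 : (0 : ℝ) < n := by exact_mod_cast hn1.1
      have hXn : X < n := by
        refine Nat.lt_of_floor_lt (not_le.mp fun h => hn' ?_)
        exact Finset.mem_Ioc.mpr ⟨hn1.1, h⟩
      have : Real.log (X / n) ≤ 0 :=
        Real.log_nonpos (by positivity) ((div_le_one hn0).mpr hXn.le)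
      simp [hg, max_eq_right this]
  rw [hS2, ← hS1]

/-- An untwisted log-mean over `n ≤ X` with `X < 1` is an empty sum. [cite: Zhang2022LandauSiegel, §10 Lemma 10.2 (proof)] -/
theorem logMean_eq_zero_of_lt_one (w : ℕ → ℂ) {X : ℝ} (hX : X < 1) :
    ∑ n ∈ Finset.Ioc 0 ⌊X⌋₊, w n * (Real.log (X / n) : ℂ) = 0 := by
  rcases lt_or_ge X 0 with h | h
  · rw [Nat.floor_of_nonpos h.le]; simp
  · rw [Nat.floor_eq_zero.mpr hX]; simp

/-- **`𝔳₂ⱼ(d,r)` as three untwisted log-means** (the content of "In view of (8.9) and (10.6)", p.55):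
for `d, r ≥ 1` and `P > 1`,
`𝔳₂ⱼ(d,r) = (500/log P)(A(P^{0.504}/dr) − 2A(P^{0.502}/dr) + A(P^{0.5}/dr))`,
`A(X) = Σ_{n≤X} χ(n)ξ₀ⱼ(n;d,r)n⁻¹log(X/n)`. [cite: Zhang2022LandauSiegel, §10 Lemma 10.2 (proof), (10.6)] -/
theorem frakv2_eq_logMeans (c' : ℝ) (j : ℕ) {d r : ℕ} (hd : 1 ≤ d) (hr : 1 ≤ r)
    (hP : 1 < bigP D) :
    frakv2 c' χ j d r = ((500 / Real.log (bigP D) : ℝ) : ℂ) *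
      ((∑ n ∈ Finset.Ioc 0 ⌊bigP D ^ (0.504 : ℝ) / ((d * r : ℕ) : ℝ)⌋₊,
          χ (n : ZMod D) * xiZero c' D j n d r / (n : ℂ) *
            (Real.log (bigP D ^ (0.504 : ℝ) / ((d * r : ℕ) : ℝ) / n) : ℂ)) -
        2 * (∑ n ∈ Finset.Ioc 0 ⌊bigP D ^ (0.502 : ℝ) / ((d * r : ℕ) : ℝ)⌋₊,
          χ (n : ZMod D) * xiZero c' D j n d r / (n : ℂ) *
            (Real.log (bigP D ^ (0.502 : ℝ) / ((d * r : ℕ) : ℝ) / n) : ℂ)) +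
        (∑ n ∈ Finset.Ioc 0 ⌊bigP D ^ (0.5 : ℝ) / ((d * r : ℕ) : ℝ)⌋₊,
          χ (n : ZMod D) * xiZero c' D j n d r / (n : ℂ) *
            (Real.log (bigP D ^ (0.5 : ℝ) / ((d * r : ℕ) : ℝ) / n) : ℂ))) := by
  have hP0 : 0 < bigP D := by linarith
  set P : ℝ := bigP D with hPdef
  set y : ℝ := ((d * r : ℕ) : ℝ) with hydef
  have hy1 : 1 ≤ y := by
    have : 1 ≤ d * r := Nat.one_le_iff_ne_zero.mpr (Nat.mul_ne_zero (by omega) (by omega))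
    rw [hydef]; exact_mod_cast this
  have hy0 : 0 < y := by linarith
  set w : ℕ → ℂ := fun n => χ (n : ZMod D) * xiZero c' D j n d r / (n : ℂ) with hw
  -- `X_a = P^a/y` satisfies `0 < X_a ≤ ⌈P⌉₊` for `a ≤ 1`
  have hXpos : ∀ a : ℝ, 0 < P ^ a / y := fun a => by positivity
  have hXQ : ∀ a : ℝ, a ≤ 1 → P ^ a / y ≤ (⌈P⌉₊ : ℕ) := by
    intro a ha
    calc P ^ a / y ≤ P ^ a := div_le_self (by positivity) hy1
      _ ≤ P ^ (1 : ℝ) := Real.rpow_le_rpow_of_exponent_le hP.le ha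
      _ = P := Real.rpow_one P
      _ ≤ (⌈P⌉₊ : ℕ) := Nat.le_ceil P
  -- rewrite each summand
  have hterm : ∀ n ∈ Finset.Ico 1 ⌈P⌉₊,
      χ (n : ZMod D) * (ftilde (Real.log ((d * r * n : ℕ) : ℝ) / Real.log P) : ℂ) *
          xiZero c' D j n d r / (n : ℂ) =
        ((500 / Real.log P : ℝ) : ℂ) *
          (w n * ((max (Real.log (P ^ (0.504 : ℝ) / y / n)) 0 : ℝ) : ℂ) -
            2 * (w n * ((max (Real.log (P ^ (0.502 : ℝ) / y / n)) 0 : ℝ) : ℂ)) +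
            w n * ((max (Real.log (P ^ (0.5 : ℝ) / y / n)) 0 : ℝ) : ℂ)) := by
    intro n hn
    rw [Finset.mem_Ico] at hn
    have hn0 : (0 : ℝ) < n := by exact_mod_cast hn.1
    have hcast : ((d * r * n : ℕ) : ℝ) = y * n := by rw [hydef]; push_cast; ring
    rw [hcast, ftilde_log_eq hP hy0 hn0, hw]
    push_cast
    ring
  rw [frakv2, Finset.sum_congr rfl hterm, ← Finset.mul_sum, Finset.sum_add_distrib,
    Finset.sum_sub_distrib, ← Finset.mul_sum,
    sum_ramp_eq' w (hXpos _) (hXQ _ (by norm_num)),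
    sum_ramp_eq' w (hXpos _) (hXQ _ (by norm_num)),
    sum_ramp_eq' w (hXpos _) (hXQ _ (by norm_num))]

/-! ### The residues of the shift-0 model, combined over the tent -/

/-- `log(Pᵃ/y) = a·log P − log y`. [folklore] -/
private theorem log_rpow_div {P y : ℝ} (hP : 0 < P) (hy : 0 < y) (a : ℝ) :
    Real.log (P ^ a / y) = a * Real.log P - Real.log y := by
  rw [Real.log_div (by positivity) hy.ne', Real.log_rpow hP]

/-- **The three-term combination** (range `dr ≤ P^{0.5}/T`, (10.8)): with `X_k = P^{a_k}/y`,
`(a_k) = (0.504, 0.502, 0.5)`, `(c_k) = (1, −2, 1)`: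
`Σ_k c_k(1 + (β_a+β_b)log X_k + ½β_aβ_b log²X_k) = β_aβ_b(log P/500)²` (`Σc_k = Σc_k log X_k = 0`,
`Σc_k log²X_k = 2(log P/500)²`) — the value of the circle integral of u019
(`Typed.Sec10A.residue102a_eq`). [cite: Zhang2022LandauSiegel, §10 (10.8), p.56] -/
theorem resComb_three {P y : ℝ} (hP : 0 < P) (hy : 0 < y) (βa βb : ℂ) :
    (1 + (βa + βb) * (Real.log (P ^ (0.504 : ℝ) / y) : ℂ) +
        βa * βb * (Real.log (P ^ (0.504 : ℝ) / y) : ℂ) ^ 2 / 2) -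
      2 * (1 + (βa + βb) * (Real.log (P ^ (0.502 : ℝ) / y) : ℂ) +
        βa * βb * (Real.log (P ^ (0.502 : ℝ) / y) : ℂ) ^ 2 / 2) +
      (1 + (βa + βb) * (Real.log (P ^ (0.5 : ℝ) / y) : ℂ) +
        βa * βb * (Real.log (P ^ (0.5 : ℝ) / y) : ℂ) ^ 2 / 2) =
      βa * βb * (((Real.log P / 500) ^ 2 : ℝ) : ℂ) := by
  rw [log_rpow_div hP hy, log_rpow_div hP hy, log_rpow_div hP hy]
  push_cast
  ring

/-- **The two-term combination** (range of (10.9)): with `X₁ = P^{0.504}/y`, `X₂ = P^{0.502}/y`,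
`(1 + (β_a+β_b)log X₁ + ½β_aβ_b log²X₁) − 2(1 + (β_a+β_b)log X₂ + ½β_aβ_b log²X₂) = −1 + 𝔶₁ⱼ(y)`
(`Skeleton.fraky1`; the value of the circle integral of u021, `Typed.Sec10A.residue102b_eq`).
[cite: Zhang2022LandauSiegel, §10 (10.9), p.56] -/
theorem resComb_two (c' : ℝ) (D : ℕ) (j : ℕ) {y : ℝ} (hy : 0 < y) :
    (1 + (betaJ c' D (j + 1) + betaJ c' D (j + 2)) * (Real.log (bigP D ^ (0.504 : ℝ) / y) : ℂ) +
        betaJ c' D (j + 1) * betaJ c' D (j + 2) * (Real.log (bigP D ^ (0.504 : ℝ) / y) : ℂ) ^ 2 / 2) -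
      2 * (1 + (betaJ c' D (j + 1) + betaJ c' D (j + 2)) * (Real.log (bigP D ^ (0.502 : ℝ) / y) : ℂ) +
        betaJ c' D (j + 1) * betaJ c' D (j + 2) * (Real.log (bigP D ^ (0.502 : ℝ) / y) : ℂ) ^ 2 / 2) =
      -1 + fraky1 c' D j y := by
  have hP : 0 < bigP D := Real.exp_pos _
  rw [fraky1, log_rpow_div hP hy, log_rpow_div hP hy,
    Real.log_div hy.ne' (Real.rpow_pos_of_pos hP _).ne', Real.log_rpow hP]
  push_cast
  ring

/-- **The one-term "combination"** (range of (10.10)): with `X₁ = P^{0.504}/y`,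
`1 + (β_a+β_b)log X₁ + ½β_aβ_b log²X₁ = 1 + 𝔶₂ⱼ(y)` (`Skeleton.fraky2`; the value of the circle
integral of u022, `Typed.Sec10A.residue102c_eq`). [cite: Zhang2022LandauSiegel, §10 (10.10), p.56] -/
theorem resComb_one (c' : ℝ) (D : ℕ) (j : ℕ) (y : ℝ) :
    1 + (betaJ c' D (j + 1) + betaJ c' D (j + 2)) * (Real.log (bigP D ^ (0.504 : ℝ) / y) : ℂ) +
        betaJ c' D (j + 1) * betaJ c' D (j + 2) * (Real.log (bigP D ^ (0.504 : ℝ) / y) : ℂ) ^ 2 / 2 =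
      1 + fraky2 c' D j y := by
  rw [fraky2]
  ring

end Literature.NumberTheory.LFunctions.Zhang2022.Lemma102
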